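import Literature.MathematicalPhysics.QuantumFieldTheory.Balaban1983to89.B1DeltaGRegularRegion
import Literature.MathematicalPhysics.QuantumFieldTheory.Balaban1983to89.B1DeltaGCutoff

/-!
# `Balaban1983to89.B1DeltaGCutoffPairing` — [Balaban1983RegularityDecay] **(1.11) / Cor. 2.3 (2.30) second sentence: the `L²` pairing of
# `δG_k(Ω,Ω₀,A) = G_k(Ω,A) − G_k(Ω₀,A)` AT A REGULAR `A` FOR NESTED REGIONS `Ω ⊆ Ω₀` of `T_ε` on the CONCRETE (Higgs)₂,₃ carrier, with the
# printed decay `exp(−δ₀dist(supp f, Ωᶜ) − δ₀dist(supp f′, Ωᶜ))`** — the one-theorem combination of r14 g14's assembled bound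
# (`B1DeltaGRegularRegion.deltaG_pairing_of_cutoff`, p329030) with r14 g14's adapted cutoff (`B1DeltaGCutoff`, p329499)

statement-level skeleton of published theorems with citation tags; proofs where landed; nothing here is a claim about the Yang–Mills mass gap

PDF held: `paper:balaban1983-cmp89-regularity-decay` p. 573 [PDF 3] ((1.11)–(1.12)), p. 580–581 [PDF 10–11] (Cor. 2.3).  WHAT IS PRINTED
(verbatim, p. 581 L1–2 — re-keyed in v1.1, doc-only, referee note S-B1-g46-1; v1.0 carried here a PARAPHRASE (ours) mislabelled verbatim):
*"The same inequalities hold for δG_k(Ω,Ω₀,A) with the additional factor e^{−δ₀(dist(supp f,Ωᶜ)+dist(supp f′,Ωᶜ))}"* (the "same inequalities"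
= (2.30) p. 580, the four pairings of G_k(Ω,A) bounded by c₀e^{−δ₀dist(supp f, supp f′)}‖f‖₂‖f′‖₂).

CITATION HEADER (lean-in-tree rule).  T. Bałaban, *Regularity and decay of lattice Green's functions*, Commun. Math. Phys. **89** (1983) 571–597
[Balaban1983RegularityDecay], (1.11) p. 573, Cor. 2.3 (2.30) p. 580; [Balaban1982Higgs1] (2.20)–(2.23) p. 610.  Cell `lit-balaban`, reader/typer
seat **r14** gen 14 (unit `lit-balaban-r14`; TAKING line HOME/STATUS.md 2026-08-22T07:18:39Z; design note `lit-balaban-r14/DESIGN-deltaG-pairings.md`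
+ ADDENDUM); SKELETON rows **B1.Prop2.3 / B1.Prop2.1** (cells: the `δG`-input of (2.38)/(5.5) at the `G`-level, now for NESTED pairs at a regular
`A`) and r01's **B4.Cor2.3** (model-instance material; no head change).  USED BY NAME, never restated: `B1DeltaGRegularRegion.deltaG_pairing_of_cutoff`
(p329030) and every §2–§3 lemma of `B1DeltaGCutoff` (p329499); `B2Ineq329ZeroAveraging.mesh_eq`.

WHAT THIS FILE PROVES (kernel-checked, zero `sorry`, one theorem; axioms standard).  **`deltaG_pairing_regular_region`**: for `Ω ⊆ Ω₀` unions of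
`k`-blocks with a point `z₀ ∉ Ω`, (2.20)-coercivity `γ` at `A` on the `Ω`- and on the `Ω₀`-supported fields (both follow from (2.23)-regularity on
`Ω₀` by r14 g14 `B1Ineq18RegularRegion.coercive_covOpK_of_reg223`), admissible `δ` (`B1Cor23RegularRegion.delta_admissible`), an integer `M ≥ 1`,
and `f, f′ ⊂ Ω` whose supports are at lattice distance `≥ ρ, ρ′` from `Ωᶜ`:
`|⟨f, (G^ε_k(Ω,A) − G^ε_k(Ω₀,A))f′⟩| ≤ [4/γ + 2√d·c_D·(2/γ)e^{δ}/M + (2/M)a_k(2/γ)²]·e^{2δ(M+3)}·(L^kε)²·e^{−δρ/L^k}·e^{−δρ′/L^k}·‖f‖‖f′‖`,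
`c_D = 2/√γ + 4√d·δ/γ` — UNIFORM IN `k` (take `M = 1`).  Proof = `deltaG_pairing_of_cutoff` with `χ = cutoff Ωᶜ z₀ M k`, `κ = 1/(ML^k)`,
`κ′ = 1/M`, `S = jumpBonds`, `Y = collarBlocks`, `T = transition`, `r = ρ − (M+3)L^k`; `κ·ε^{−1}·(L^kε) = 1/M` by `mesh_eq`.
HONEST SCOPE.  (i) the printed `dist` is the `L^kε`-scaled one; here distances are in lattice steps divided by `L^k` (as in all r14 files,
`ssdistSteps/L^k`), the factor `e^{2δ(M+3)} ≤ e^{8}` is explicit in the constant; (ii) only the plain pairing `⟨f, δG f′⟩` (the `dpair n = 0`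
clause of `B4.Cor23Printed`); the three derivative variants and the joint decay in `dist(supp f, supp f′)` (by `min` with the first pairings
p322845) are the successor's items, as is packaging into `B4.Cor23Printed` for nested pairs (`B1Cor23RegularDiagFam`-style index with `Ω₀`);
(iii) METHOD divergence from the print (cutoff–commutator instead of the random walk) as disclosed in `B1DeltaGRegularRegion`; (iv) hypothesis
`z₀ ∉ Ω` excludes `Ω = T_ε` (then `Ω₀ = Ω` and `δG = 0`, `B1Cor23RegularDiagFam.dpair_eq_zero`); (v) NOT summit progress.
-/

noncomputable section

namespace Literature.MathematicalPhysics.QuantumFieldTheory.Balaban1983to89.B1DeltaGCutoffPairing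

open HiggsLattice HiggsAveraging HiggsCovariance HiggsCovariancePos
open B2Ineq329ZeroAveraging (mesh_eq)
open B1DeltaGRegularRegion (deltaG_pairing_of_cutoff)
open B1DeltaGCutoff

variable {P : HiggsLattice.Params} {N : ℕ} {k : ℕ}

set_option maxHeartbeats 800000 in
/-- **[13] (1.11) / Cor. 2.3 (2.30) second sentence — the `L²` pairing of `δG^ε_k(Ω,Ω₀,A) = G^ε_k(Ω,A) − G^ε_k(Ω₀,A)` at a regular `A` on the
concrete carrier, PRINTED SHAPE up to the lattice normalisation of distances**: for `Ω ⊆ Ω₀` unions of `k`-blocks with `Ωᶜ ≠ ∅` (an element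
`z₀ ∉ Ω` given), (2.20)-coercivity `γ` at `A` on the `Ω`- and `Ω₀`-supported fields, admissible `δ`, an integer `M ≥ 1`, and `f, f′ ⊂ Ω` with
`dist(supp f, Ωᶜ) ≥ ρ`, `dist(supp f′, Ωᶜ) ≥ ρ′` (lattice steps):
`|⟨f, δG f′⟩| ≤ [4/γ + (2√d·c_D·(2/γ)e^{δ})/M + (2/M)a_k(2/γ)²]·e^{2δ(M+3)}·(L^kε)²·e^{−δρ/L^k}e^{−δρ′/L^k}‖f‖‖f′‖` — uniform in `k`.
[cite: Balaban1983RegularityDecay, (1.11) p.573, Cor. 2.3 (2.30) p.580] -/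
theorem deltaG_pairing_regular_region (C : ChargeData N) (A : HiggsLattice.VecField P 0) {msq a : ℝ} (hk : k ≤ P.K)
    (Ω Ω₀ : Finset (HiggsLattice.Site P 0))
    (hΩ : ∀ x x' : HiggsLattice.Site P 0, blockIter k x = blockIter k x' → (x ∈ Ω ↔ x' ∈ Ω))
    (hΩ₀ : ∀ x x' : HiggsLattice.Site P 0, blockIter k x = blockIter k x' → (x ∈ Ω₀ ↔ x' ∈ Ω₀)) (hsub : Ω ⊆ Ω₀)
    (z₀ : (Finset.univ.filter fun y : HiggsLattice.Site P 0 => y ∉ Ω))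
    (hmsq : 0 < msq) (hak : 0 ≤ B1.aSeq a P.L k) {γ : ℝ} (hγ : 0 < γ)
    (hlow : ∀ w : ScalarField P 0 N, (∀ x, x ∉ Ω → w x = 0) →
      γ * ((P.mesh k)⁻¹ ^ 2) * siteInner w w ≤ siteInner w (covOpK C Ω A msq a k w))
    (hlow₀ : ∀ w : ScalarField P 0 N, (∀ x, x ∉ Ω₀ → w x = 0) →
      γ * ((P.mesh k)⁻¹ ^ 2) * siteInner w w ≤ siteInner w (covOpK C Ω₀ A msq a k w))
    {δ : ℝ} (hδ0 : 0 ≤ δ) (hδ1 : δ ≤ 1) (hδ : 2 * (2 * P.d * δ ^ 2 + B1.aSeq a P.L k * (2 * δ)) ≤ γ)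
    (M : ℕ) (hM : 1 ≤ M)
    (f f' : ScalarField P 0 N) (hf : ∀ x, x ∉ Ω → f x = 0) (hf' : ∀ x, x ∉ Ω → f' x = 0) (ρ ρ' : ℝ)
    (hρ : ∀ x, f x ≠ 0 → ρ ≤ (distTo (Finset.univ.filter fun y : HiggsLattice.Site P 0 => y ∉ Ω) z₀ x : ℝ))
    (hρ' : ∀ x, f' x ≠ 0 → ρ' ≤ (distTo (Finset.univ.filter fun y : HiggsLattice.Site P 0 => y ∉ Ω) z₀ x : ℝ)) :
    |siteInner f (propagatorK C Ω A msq a k f') - siteInner f (propagatorK C Ω₀ A msq a k f')|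
      ≤ (4 / γ + (2 * Real.sqrt P.d * (2 / Real.sqrt γ + 4 * Real.sqrt P.d * δ / γ) * (2 / γ) * Real.exp δ) / M
            + 2 / M * B1.aSeq a P.L k * (2 / γ) ^ 2)
        * Real.exp (2 * (δ * ((M : ℝ) + 3))) * P.mesh k ^ 2
        * Real.exp (-(δ * (ρ / (P.L : ℝ) ^ k))) * Real.exp (-(δ * (ρ' / (P.L : ℝ) ^ k)))
        * Real.sqrt (siteInner f f) * Real.sqrt (siteInner f' f') := by
  classical
  set Z : Finset (HiggsLattice.Site P 0) := Finset.univ.filter fun y : HiggsLattice.Site P 0 => y ∉ Ω with hZdef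
  have hZΩ : ∀ y, y ∉ Ω → y ∈ Z := fun y hy => Finset.mem_filter.2 ⟨Finset.mem_univ _, hy⟩
  have hM' : (0 : ℝ) < M := by exact_mod_cast hM
  have hLk : (0 : ℝ) < (P.L : ℝ) ^ k := pow_pos (by exact_mod_cast P.hL) _
  have hMk : 0 < P.mesh k := P.mesh_pos k
  -- the cutoff data
  set χ := cutoff Z z₀ M k with hχ
  have H := deltaG_pairing_of_cutoff C A hk Ω Ω₀ hΩ hΩ₀ hsub hmsq hak hγ hlow hlow₀ hδ0 hδ1 hδ χ
    (cutoff_nonneg Z z₀ M k) (cutoff_le_one Z z₀ M k)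
    (fun b _ hb => cutoff_boundary_bond Z z₀ M k Ω hZΩ b hb)
    (κ := 1 / ((M : ℝ) * (P.L : ℝ) ^ k)) (by positivity) (abs_cutoff_bond_le Z z₀ M k hM)
    (jumpBonds Z z₀ M k Ω) (fun b hb => inside_of_mem_jumpBonds Z z₀ M k Ω hb) (fun b hb hj => mem_jumpBonds Z z₀ M k Ω hb hj)
    (κ' := 1 / (M : ℝ)) (by positivity) (fun x x' h => abs_cutoff_block_le Z z₀ M k hM hk h)
    (collarBlocks Z z₀ M k Ω) (fun x x' h hy => cutoff_const_off_collarBlocks Z z₀ M k Ω hM hΩ hZΩ h hy)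
    (transition Z z₀ M k Ω) (fun x hx h => mem_transition_of_cutoff_ne_one Z z₀ M k Ω hM hx h)
    (fun b hb => src_mem_transition_of_mem_jumpBonds Z z₀ M k Ω hM hb) (fun x hx => (mem_transition_iff Z z₀ M k Ω x).2 hx)
    f f' hf hf' (ρ - ((M : ℝ) + 3) * (P.L : ℝ) ^ k) (ρ' - ((M : ℝ) + 3) * (P.L : ℝ) ^ k)
    (fun x t hx ht => sep_of_le_distTo Z z₀ M k Ω hk (hρ x hx) ht)
    (fun x t hx ht => sep_of_le_distTo Z z₀ M k Ω hk (hρ' x hx) ht)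
  -- constants: κ ε⁻¹ (L^kε) = 1/M and the exponentials
  have hmesh : P.mesh k = (P.L : ℝ) ^ k * P.mesh 0 := mesh_eq k
  have hm0 : 0 < P.mesh 0 := P.mesh_pos 0
  have hκ : 1 / ((M : ℝ) * (P.L : ℝ) ^ k) * (P.mesh 0)⁻¹ * P.mesh k = 1 / M := by
    rw [hmesh]; field_simp
  have hexp : ∀ ρ₁ : ℝ, Real.exp (-(δ * ((ρ₁ - ((M : ℝ) + 3) * (P.L : ℝ) ^ k) / (P.L : ℝ) ^ k)))
      = Real.exp (δ * ((M : ℝ) + 3)) * Real.exp (-(δ * (ρ₁ / (P.L : ℝ) ^ k))) := by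
    intro ρ₁
    rw [← Real.exp_add]
    congr 1
    field_simp
    ring
  rw [hκ, hexp ρ, hexp ρ'] at H
  refine H.trans (le_of_eq ?_)
  have e2 : Real.exp (2 * (δ * ((M : ℝ) + 3))) = Real.exp (δ * ((M : ℝ) + 3)) * Real.exp (δ * ((M : ℝ) + 3)) := by
    rw [two_mul, Real.exp_add]
  rw [e2]
  ring

end Literature.MathematicalPhysics.QuantumFieldTheory.Balaban1983to89.B1DeltaGCutoffPairing

end
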